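import Summits.CriticalPhenomena.SAWScalingLimit.Theses.SAWParafermion
import Summits.CriticalPhenomena.SAWScalingLimit.Theses.SAWRenewalTightness
import Summits.CriticalPhenomena.SAWScalingLimit.Theorems.SubseqIdentification.Negative.ProbabilityRedundant
import Summits.CriticalPhenomena.SAWScalingLimit.Theorems.SAWRenewalTightnessSubseqIdentificationReferenceWindow
import Summits.CriticalPhenomena.SAWScalingLimit.Theorems.SAWRenewalTightnessSubseqIdentificationAreaLawOfLimit
import Summits.CriticalPhenomena.SAWScalingLimit.Theorems.SAWRenewalTightnessSubseqIdentificationKappaPinHalfPlane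
import Summits.CriticalPhenomena.SAWScalingLimit.Theorems.SAWRenewalTightnessSubseqIdentificationWindowTransport
import Summits.CriticalPhenomena.SAWScalingLimit.Theorems.SAWRenewalTightnessSubseqIdentificationKappaPinGlue

/-!
# Line `boundary-area-law` for crux `SubseqIdentification` (stmt-CriticalPhenomena-0783): the reduction theorem

The crux `SubseqIdentification` (every subsequential weak limit of the critical `δℤ²` SAW laws of a
Dobrushin domain is chordal SLE_{8/3}; identical decls `SAWParafermion.SubseqIdentification` /
`SAWRenewalTightness.SubseqIdentification`) follows from exactly THREE inputs, all else being proved in the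
tree (this file is sorry-free):

* the DOCK `IdentificationUpToKappa` — for every mesh sequence `s → 0⁺` one `κ > 0` such that every weak
  limit along `s`, in every Dobrushin domain, is SLE_κ (hypothesis `h₁`; the conformal half of the
  conjecture, nearest registered supplier stmt-CriticalPhenomena-0771 `SAWConfRestriction.ConfCovLimit` plus a
  one-domain Schramm principle, see `SAWRenewalTightnessSubseqIdentificationDockReductions`);
* the LATTICE BOUNDARY AREA LAW `LatticeAreaLaw` — at a flat wall point `x₀ ∉ {a, b}` the critical SAW comes
  within `r` of `x₀` with probability `≍ r²` in self-normalising ratio form, pointwise in `r`, eventually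
  in `δ` (hypothesis `h₄`; the boundary two-leg exponent `x₂ˢ = 2` of the critical `ℤ²` SAW — OPEN);
* TIGHTNESS `SAWRenewalTightness.EventualTight` (stmt-CriticalPhenomena-1372, the route's other half).

Everything else of the line is a theorem of the tree and is consumed here BY NAME: the reference square
with a flat window (`stub_referenceWindow`), the portmanteau passage (`stub_areaLawOfLimit`), and the
κ-pin `8/κ − 1 = 2 ⇔ κ = 8/3` for SLE_κ laws at a flat window (`stub_kappaPinGlue stub_kappaPinHalfPlane
stub_windowTransport`: Alberts–Kozdron upper bound, Beffara lower bound, Rohde–Schramm space filling,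
Carathéodory + Schwarz reflection). The Prokhorov extraction `subseqLimitsExist_of_eventualTight` is proved
here. `SubseqIdentification_of` is the general composition (six hypotheses);
`SubseqIdentification_of_dock_of_latticeAreaLaw` is the line's reduction theorem (three hypotheses);
`latticeAreaLaw_of_fixedMesh` records that the fixed-mesh (mechanism) form of the area law implies `h₄`.
-/

open MeasureTheory Filter Topology Set
open scoped NNReal ENNReal BoundedContinuousFunction

namespace Summit.CriticalPhenomena.SAWScalingLimit.Theorems.SubseqIdentification.BoundaryAreaLaw

open Literature.Probability.RandomPlanarGeometry Literature.Probability.LatticeModels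
open Summit.CriticalPhenomena.SAWScalingLimit.Theses.SAWParafermion (SubseqIdentification)
open Summit.CriticalPhenomena.SAWScalingLimit.Theses.SAWRenewalTightness (EventualTight)

/-- **`EventualTight` ⇒ subsequential limits exist along every mesh sequence** (generation 1's stub S3,
now DERIVED from the route's registered target T′ = stmt-CriticalPhenomena-1372): for every Dobrushin domain, endpoint
approximation and `s → 0⁺` there are a subsequence `s ∘ φ` and a probability measure `μ` on `CurveClass ℂ`
such that the pushed critical SAW laws converge weakly to `μ` along `s ∘ φ`. Re-hosts the disprover's
`exists_subseqConv_of_isTightAlongMesh` / `isTightAlongMesh_of_eventualTight` (Disproof cycle 2 §5.4):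
the laws are probability measures past the junk meshes (`Negative.eventually_isProbabilityMeasure_law`),
`EventualTight` gives tightness along the mesh (`isTightAlongMesh_of_isTightMeasureSet_image`), the
sequence of image laws is a tight set (`isTightMeasureSet_range_of_eventually`), and Prokhorov on the
Polish `CurveClass ℂ` (`isCompact_closure_of_isTightMeasureSet`) extracts the subsequence. [folklore] -/
theorem subseqLimitsExist_of_eventualTight (hT : EventualTight) :
    ∀ (D : DobrushinDomain) (a b : ℝ → Site 2), SAW.IsEndpointApprox D a b →
      ∀ (s : ℕ → ℝ), Tendsto s atTop (𝓝[>] (0 : ℝ)) →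
        ∃ φ : ℕ → ℕ, StrictMono φ ∧ ∃ μ : Measure (CurveClass ℂ), IsProbabilityMeasure μ ∧
          ∀ f : CurveClass ℂ →ᵇ ℝ,
            Tendsto (fun n => ∫ γ, f γ.curve
                ∂(SAW.law D.carrier (s (φ n)) (a (s (φ n))) (b (s (φ n)))))
              atTop (𝓝 (∫ x, f x ∂μ)) := by
  intro D a b hab s hs
  -- tightness along the mesh, from the route's `EventualTight`
  have hT' : IsTightAlongMesh (fun δ (γ : SAW.DomainSAW D.carrier δ (a δ) (b δ)) => γ.curve)
      (fun δ => SAW.law D.carrier δ (a δ) (b δ)) := by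
    obtain ⟨δ₀, hδ₀, h⟩ := hT D a b hab
    exact isTightAlongMesh_of_isTightMeasureSet_image
      (Eventually.of_forall fun δ => (SAW.DomainSAW.measurable_of_top _).aemeasurable) hδ₀ h
  -- past some index the laws are probability measures
  obtain ⟨N, hN⟩ := eventually_atTop.1 (hs.eventually
    (Summit.CriticalPhenomena.SAWScalingLimit.Theorems.SubseqIdentification.Negative.eventually_isProbabilityMeasure_law
      hab))
  have hN' : ∀ n, IsProbabilityMeasure (SAW.law D.carrier (s (n + N)) (a (s (n + N))) (b (s (n + N)))) :=
    fun n => hN _ (N.le_add_left n)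
  let ν : ℕ → ProbabilityMeasure (CurveClass ℂ) := fun n =>
    ⟨(SAW.law D.carrier (s (n + N)) (a (s (n + N))) (b (s (n + N)))).map (fun γ => γ.curve),
      Measure.isProbabilityMeasure_map (SAW.DomainSAW.measurable_of_top _).aemeasurable⟩
  have hνapply : ∀ n (K : Set (CurveClass ℂ)), IsClosed K → (ν n : Measure (CurveClass ℂ)) Kᶜ =
      SAW.law D.carrier (s (n + N)) (a (s (n + N))) (b (s (n + N))) ((fun γ => γ.curve) ⁻¹' Kᶜ) :=
    fun n K hK => Measure.map_apply (SAW.DomainSAW.measurable_of_top _) hK.isOpen_compl.measurableSet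
  have htight : IsTightMeasureSet
      {((μ : ProbabilityMeasure (CurveClass ℂ)) : Measure (CurveClass ℂ)) | μ ∈ Set.range ν} := by
    have hrange : {((μ : ProbabilityMeasure (CurveClass ℂ)) : Measure (CurveClass ℂ)) | μ ∈ Set.range ν}
        = Set.range (fun n => (ν n : Measure (CurveClass ℂ))) := by
      ext x
      simp only [Set.mem_range, Set.mem_setOf_eq]
      constructor
      · rintro ⟨μ, ⟨n, rfl⟩, rfl⟩
        exact ⟨n, rfl⟩
      · rintro ⟨n, rfl⟩
        exact ⟨ν n, ⟨n, rfl⟩, rfl⟩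
    rw [hrange]
    haveI : ∀ n, IsFiniteMeasure ((fun n => (ν n : Measure (CurveClass ℂ))) n) := fun n => by
      change IsFiniteMeasure (ν n : Measure (CurveClass ℂ))
      infer_instance
    refine isTightMeasureSet_range_of_eventually fun ε hε => ?_
    obtain ⟨K, hK, hev⟩ := hT' ε hε
    refine ⟨K, hK, ?_⟩
    have hs' : Tendsto (fun n => s (n + N)) atTop (𝓝[>] (0 : ℝ)) := hs.comp (tendsto_add_atTop_nat N)
    filter_upwards [hs'.eventually hev] with n hn
    rwa [hνapply n K hK.isClosed]
  have hcomp := isCompact_closure_of_isTightMeasureSet htight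
  obtain ⟨μ, -, φ, hφ, hlim⟩ := hcomp.isSeqCompact fun n => subset_closure (Set.mem_range_self n)
  refine ⟨fun n => φ n + N, fun m n hmn => Nat.add_lt_add_right (hφ hmn) N, μ, inferInstance,
    fun f => ?_⟩
  have := (ProbabilityMeasure.tendsto_iff_forall_integral_tendsto.1 hlim) f
  refine this.congr fun n => ?_
  change ∫ x, f x ∂((SAW.law D.carrier (s (φ n + N)) (a (s (φ n + N))) (b (s (φ n + N)))).map
    (fun γ => γ.curve)) = _
  exact integral_map (SAW.DomainSAW.measurable_of_top _).aemeasurable f.continuous.aestronglyMeasurable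

/-- **Composition `S1 → S2 → (T′-consequence) → S4 → S5 → S6 → SubseqIdentification` (kernel-checked, no
`sorry`).** Given the crux hypotheses for `(D; a, b)`, `s`, `μ`: take the reference square `(D₀; a₀, b₀)`
with its flat window at `x₀` (S2) and a subsequential limit `μ₀` of its SAW laws along `s ∘ φ` (h₃, the
consequence of T′); the dock (S1) applied to the sequence `s ∘ φ` gives ONE `κ > 0` with `μ = SLE_κ(D)`
(the laws in `D` still converge to `μ` along the subsequence) and `μ₀ = SLE_κ(D₀)`; the lattice area law in
`D₀` at `x₀` (S4), transported along `s ∘ φ` (`Tendsto.eventually`, radius by radius) and passed to the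
limit (S5, with non-degeneracy from S6 (i)), gives the two-sided `r²` law for `μ₀`, and the pin (S6 (ii))
gives `κ = 8/3`; hence `IsSLELaw (8/3) D μ`, which is `SAWParafermion.SubseqIdentification` BY NAME (the
ledger's primary decl of stmt-CriticalPhenomena-0783; the identical shared decl `SAWRenewalTightness.SubseqIdentification`
follows definitionally, `SubseqIdentification_renewalTightness`). -/
theorem SubseqIdentification_of
    (h₁ : ∀ (s : ℕ → ℝ), Tendsto s atTop (𝓝[>] (0 : ℝ)) →
      ∃ κ : ℝ≥0, 0 < κ ∧
        ∀ (D : DobrushinDomain) (a b : ℝ → Site 2), SAW.IsEndpointApprox D a b →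
          ∀ (μ : Measure (CurveClass ℂ)), IsProbabilityMeasure μ →
            (∀ f : CurveClass ℂ →ᵇ ℝ,
              Tendsto (fun n => ∫ γ, f γ.curve ∂(SAW.law D.carrier (s n) (a (s n)) (b (s n))))
                atTop (𝓝 (∫ x, f x ∂μ))) →
            IsSLELaw κ D μ)
    (h₂ : ∃ (D₀ : DobrushinDomain) (a₀ b₀ : ℝ → Site 2) (x₀ : ℂ) (ρ₀ : ℝ),
      SAW.IsEndpointApprox D₀ a₀ b₀ ∧ 0 < ρ₀ ∧ x₀ ≠ D₀.pt 0 ∧ x₀ ≠ D₀.pt 1 ∧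
        D₀.carrier ∩ Metric.ball x₀ ρ₀ = {z : ℂ | x₀.im < z.im} ∩ Metric.ball x₀ ρ₀)
    (h₃ : ∀ (D : DobrushinDomain) (a b : ℝ → Site 2), SAW.IsEndpointApprox D a b →
      ∀ (s : ℕ → ℝ), Tendsto s atTop (𝓝[>] (0 : ℝ)) →
        ∃ φ : ℕ → ℕ, StrictMono φ ∧ ∃ μ : Measure (CurveClass ℂ), IsProbabilityMeasure μ ∧
          ∀ f : CurveClass ℂ →ᵇ ℝ,
            Tendsto (fun n => ∫ γ, f γ.curve
                ∂(SAW.law D.carrier (s (φ n)) (a (s (φ n))) (b (s (φ n)))))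
              atTop (𝓝 (∫ x, f x ∂μ)))
    (h₄ : ∀ (D : DobrushinDomain) (a b : ℝ → Site 2), SAW.IsEndpointApprox D a b →
      ∀ (x₀ : ℂ) (ρ₀ : ℝ), 0 < ρ₀ →
        D.carrier ∩ Metric.ball x₀ ρ₀ = {z : ℂ | x₀.im < z.im} ∩ Metric.ball x₀ ρ₀ →
        x₀ ≠ D.pt 0 → x₀ ≠ D.pt 1 →
        ∃ C ε₀ : ℝ, 0 < C ∧ 0 < ε₀ ∧ ∀ r : ℝ, 0 < r → r ≤ ε₀ →
          ∀ᶠ δ in 𝓝[>] (0 : ℝ),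
            SAW.law D.carrier δ (a δ) (b δ) {γ | Metric.infDist x₀ γ.curve.range ≤ r} *
                ENNReal.ofReal (ε₀ ^ 2) ≤
              ENNReal.ofReal C *
                SAW.law D.carrier δ (a δ) (b δ) {γ | Metric.infDist x₀ γ.curve.range ≤ ε₀} *
                  ENNReal.ofReal (r ^ 2) ∧
            SAW.law D.carrier δ (a δ) (b δ) {γ | Metric.infDist x₀ γ.curve.range ≤ ε₀} *
                ENNReal.ofReal (r ^ 2) ≤
              ENNReal.ofReal C *
                SAW.law D.carrier δ (a δ) (b δ) {γ | Metric.infDist x₀ γ.curve.range ≤ r} *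
                  ENNReal.ofReal (ε₀ ^ 2))
    (h₅ : ∀ (D : DobrushinDomain) (a b : ℝ → Site 2) (s : ℕ → ℝ) (μ : Measure (CurveClass ℂ))
        (x₀ : ℂ),
      Tendsto s atTop (𝓝[>] (0 : ℝ)) → IsProbabilityMeasure μ →
      (∀ f : CurveClass ℂ →ᵇ ℝ,
        Tendsto (fun n => ∫ γ, f γ.curve ∂(SAW.law D.carrier (s n) (a (s n)) (b (s n))))
          atTop (𝓝 (∫ x, f x ∂μ))) →
      (∃ C ε₀ : ℝ, 0 < C ∧ 0 < ε₀ ∧ ∀ r : ℝ, 0 < r → r ≤ ε₀ → ∀ᶠ n in atTop,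
          SAW.law D.carrier (s n) (a (s n)) (b (s n)) {γ | Metric.infDist x₀ γ.curve.range ≤ r} *
                ENNReal.ofReal (ε₀ ^ 2) ≤
              ENNReal.ofReal C *
                SAW.law D.carrier (s n) (a (s n)) (b (s n))
                    {γ | Metric.infDist x₀ γ.curve.range ≤ ε₀} *
                  ENNReal.ofReal (r ^ 2) ∧
            SAW.law D.carrier (s n) (a (s n)) (b (s n)) {γ | Metric.infDist x₀ γ.curve.range ≤ ε₀} *
                ENNReal.ofReal (r ^ 2) ≤
              ENNReal.ofReal C *
                SAW.law D.carrier (s n) (a (s n)) (b (s n))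
                    {γ | Metric.infDist x₀ γ.curve.range ≤ r} *
                  ENNReal.ofReal (ε₀ ^ 2)) →
      (∀ ε : ℝ, 0 < ε → 0 < μ {γ | Metric.infDist x₀ γ.range < ε}) →
      ∃ c C r₀ : ℝ, 0 < c ∧ 0 < r₀ ∧ ∀ r ∈ Set.Ioo (0 : ℝ) r₀,
        ENNReal.ofReal (c * r ^ 2) ≤ μ {γ | Metric.infDist x₀ γ.range ≤ r} ∧
          μ {γ | Metric.infDist x₀ γ.range < r} ≤ ENNReal.ofReal (C * r ^ 2))
    (h₆ : ∀ (κ : ℝ≥0) (D : DobrushinDomain) (μ : Measure (CurveClass ℂ)) (x₀ : ℂ) (ρ₀ : ℝ),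
      0 < κ → IsSLELaw κ D μ → 0 < ρ₀ →
      D.carrier ∩ Metric.ball x₀ ρ₀ = {z : ℂ | x₀.im < z.im} ∩ Metric.ball x₀ ρ₀ →
      x₀ ≠ D.pt 0 → x₀ ≠ D.pt 1 →
      (∀ ε : ℝ, 0 < ε → 0 < μ {γ | Metric.infDist x₀ γ.range < ε}) ∧
        ((∃ c C r₀ : ℝ, 0 < c ∧ 0 < r₀ ∧ ∀ r ∈ Set.Ioo (0 : ℝ) r₀,
            ENNReal.ofReal (c * r ^ 2) ≤ μ {γ | Metric.infDist x₀ γ.range ≤ r} ∧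
              μ {γ | Metric.infDist x₀ γ.range < r} ≤ ENNReal.ofReal (C * r ^ 2)) →
          κ = 8 / 3)) :
    SubseqIdentification := by
  intro D a b hab s μ hs hμ hlim
  -- S2: the reference square with its flat window
  obtain ⟨D₀, a₀, b₀, x₀, ρ₀, hab₀, hρ₀, hx0, hx1, hwin⟩ := h₂
  -- T′-consequence: a subsequential limit in the reference domain along `s ∘ φ`
  obtain ⟨φ, hφ, μ₀, hμ₀, hlim₀⟩ := h₃ D₀ a₀ b₀ hab₀ s hs
  have hs' : Tendsto (s ∘ φ) atTop (𝓝[>] (0 : ℝ)) := hs.comp hφ.tendsto_atTop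
  -- S1: one `κ` along `s ∘ φ` for both `D` and `D₀`
  obtain ⟨κ, hκ, hdock⟩ := h₁ (s ∘ φ) hs'
  have hD : IsSLELaw κ D μ :=
    hdock D a b hab μ hμ fun f => (hlim f).comp hφ.tendsto_atTop
  have hD₀ : IsSLELaw κ D₀ μ₀ := hdock D₀ a₀ b₀ hab₀ μ₀ hμ₀ hlim₀
  -- S4: the lattice area law in the reference domain, transported radius by radius along the subsequence
  obtain ⟨C, ε₀, hC, hε₀, hlaw⟩ := h₄ D₀ a₀ b₀ hab₀ x₀ ρ₀ hρ₀ hwin hx0 hx1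
  -- S6: non-degeneracy and the pin for `μ₀ = SLE_κ(D₀)`
  obtain ⟨hnd, hpin⟩ := h₆ κ D₀ μ₀ x₀ ρ₀ hκ hD₀ hρ₀ hwin hx0 hx1
  -- S5: the continuum two-sided `r²` law for `μ₀`
  have htwo := h₅ D₀ a₀ b₀ (s ∘ φ) μ₀ x₀ hs' hμ₀ hlim₀
    ⟨C, ε₀, hC, hε₀, fun r hr hrε => hs'.eventually (hlaw r hr hrε)⟩ hnd
  have hk : κ = 8 / 3 := hpin htwo
  rw [hk] at hD
  exact hD

/-- **The reduction theorem of line `boundary-area-law`: crux ⇐ DOCK ∧ LATTICE AREA LAW ∧ TIGHTNESS.**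
`SubseqIdentification` (the shared decl of route `SAWRenewalTightness`, definitionally the primary decl
`SAWParafermion.SubseqIdentification`) follows from identification up to `κ` per mesh sequence (`h₁`), the
lattice boundary area law at flat windows (`h₄`) and `EventualTight`; the reference square, the limit
passage and the SLE κ-pin are the tree's theorems `stub_referenceWindow`, `stub_areaLawOfLimit`,
`stub_kappaPinGlue stub_kappaPinHalfPlane stub_windowTransport`. [folklore] -/
theorem SubseqIdentification_of_dock_of_latticeAreaLaw :
    (∀ (s : ℕ → ℝ), Tendsto s atTop (𝓝[>] (0 : ℝ)) →
          ∃ κ : ℝ≥0, 0 < κ ∧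
            ∀ (D : DobrushinDomain) (a b : ℝ → Site 2), SAW.IsEndpointApprox D a b →
              ∀ (μ : Measure (CurveClass ℂ)), IsProbabilityMeasure μ →
                (∀ f : CurveClass ℂ →ᵇ ℝ,
                  Tendsto (fun n => ∫ γ, f γ.curve ∂(SAW.law D.carrier (s n) (a (s n)) (b (s n))))
                    atTop (𝓝 (∫ x, f x ∂μ))) →
                IsSLELaw κ D μ) →
    (∀ (D : DobrushinDomain) (a b : ℝ → Site 2), SAW.IsEndpointApprox D a b →
          ∀ (x₀ : ℂ) (ρ₀ : ℝ), 0 < ρ₀ →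
            D.carrier ∩ Metric.ball x₀ ρ₀ = {z : ℂ | x₀.im < z.im} ∩ Metric.ball x₀ ρ₀ →
            x₀ ≠ D.pt 0 → x₀ ≠ D.pt 1 →
            ∃ C ε₀ : ℝ, 0 < C ∧ 0 < ε₀ ∧ ∀ r : ℝ, 0 < r → r ≤ ε₀ →
              ∀ᶠ δ in 𝓝[>] (0 : ℝ),
                SAW.law D.carrier δ (a δ) (b δ) {γ | Metric.infDist x₀ γ.curve.range ≤ r} *
                    ENNReal.ofReal (ε₀ ^ 2) ≤
                  ENNReal.ofReal C *
                    SAW.law D.carrier δ (a δ) (b δ) {γ | Metric.infDist x₀ γ.curve.range ≤ ε₀} *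
                      ENNReal.ofReal (r ^ 2) ∧
                SAW.law D.carrier δ (a δ) (b δ) {γ | Metric.infDist x₀ γ.curve.range ≤ ε₀} *
                    ENNReal.ofReal (r ^ 2) ≤
                  ENNReal.ofReal C *
                    SAW.law D.carrier δ (a δ) (b δ) {γ | Metric.infDist x₀ γ.curve.range ≤ r} *
                      ENNReal.ofReal (ε₀ ^ 2)) →
    Summit.CriticalPhenomena.SAWScalingLimit.Theses.SAWRenewalTightness.EventualTight →
    Summit.CriticalPhenomena.SAWScalingLimit.Theses.SAWRenewalTightness.SubseqIdentification :=
  fun h₁ h₄ hT =>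
  SubseqIdentification_of h₁ stub_referenceWindow (subseqLimitsExist_of_eventualTight hT) h₄
    stub_areaLawOfLimit (stub_kappaPinGlue stub_kappaPinHalfPlane stub_windowTransport)

/-- **The fixed-mesh area law implies the registered stub S4.** The idea card's / generation 1's form of the
area law — ONE pair of constants for all small meshes `δ` and ALL mesoscopic radii `2δ ≤ r ≤ r' ≤ ε₀` at
once (what the peeling mechanism actually delivers) — implies the pointwise-in-`r` form registered as
`stub_latticeAreaLaw` (take `r' = ε₀`; for fixed `r > 0`, eventually `2δ ≤ r`). A prover who proves the
fixed-mesh law closes S4 through this lemma. [folklore] -/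
theorem latticeAreaLaw_of_fixedMesh {D : DobrushinDomain} {a b : ℝ → Site 2} {x₀ : ℂ}
    (h : ∃ C ε₀ : ℝ, 0 < C ∧ 0 < ε₀ ∧ ∀ᶠ δ in 𝓝[>] (0 : ℝ), ∀ r r' : ℝ,
          2 * δ ≤ r → r ≤ r' → r' ≤ ε₀ →
          SAW.law D.carrier δ (a δ) (b δ) {γ | Metric.infDist x₀ γ.curve.range ≤ r} *
                ENNReal.ofReal (r' ^ 2) ≤
              ENNReal.ofReal C *
                SAW.law D.carrier δ (a δ) (b δ) {γ | Metric.infDist x₀ γ.curve.range ≤ r'} *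
                  ENNReal.ofReal (r ^ 2) ∧
            SAW.law D.carrier δ (a δ) (b δ) {γ | Metric.infDist x₀ γ.curve.range ≤ r'} *
                ENNReal.ofReal (r ^ 2) ≤
              ENNReal.ofReal C *
                SAW.law D.carrier δ (a δ) (b δ) {γ | Metric.infDist x₀ γ.curve.range ≤ r} *
                  ENNReal.ofReal (r' ^ 2)) :
    ∃ C ε₀ : ℝ, 0 < C ∧ 0 < ε₀ ∧ ∀ r : ℝ, 0 < r → r ≤ ε₀ →
      ∀ᶠ δ in 𝓝[>] (0 : ℝ),
        SAW.law D.carrier δ (a δ) (b δ) {γ | Metric.infDist x₀ γ.curve.range ≤ r} *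
            ENNReal.ofReal (ε₀ ^ 2) ≤
          ENNReal.ofReal C *
            SAW.law D.carrier δ (a δ) (b δ) {γ | Metric.infDist x₀ γ.curve.range ≤ ε₀} *
              ENNReal.ofReal (r ^ 2) ∧
        SAW.law D.carrier δ (a δ) (b δ) {γ | Metric.infDist x₀ γ.curve.range ≤ ε₀} *
            ENNReal.ofReal (r ^ 2) ≤
          ENNReal.ofReal C *
            SAW.law D.carrier δ (a δ) (b δ) {γ | Metric.infDist x₀ γ.curve.range ≤ r} *
              ENNReal.ofReal (ε₀ ^ 2) := by
  obtain ⟨C, ε₀, hC, hε₀, hlaw⟩ := h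
  refine ⟨C, ε₀, hC, hε₀, fun r hr hrε => ?_⟩
  have hsmall : ∀ᶠ δ in 𝓝[>] (0 : ℝ), 2 * δ ≤ r := by
    have h2 : ∀ᶠ δ in 𝓝 (0 : ℝ), δ < r / 2 := eventually_lt_nhds (by linarith)
    exact (h2.filter_mono nhdsWithin_le_nhds).mono fun δ hδ => by linarith
  filter_upwards [hlaw, hsmall] with δ hδ h2δ
  exact hδ r ε₀ h2δ hrε le_rfl

end Summit.CriticalPhenomena.SAWScalingLimit.Theorems.SubseqIdentification.BoundaryAreaLaw
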